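import Summits.QuantumFields.YangMills.Theorems.UnitScaleTiltProp7SectET3OpsT3
import Literature.MathematicalPhysics.QuantumFieldTheory.Balaban1983to89.B9CoReadingCoordsInputLoc
import Literature.MathematicalPhysics.QuantumFieldTheory.Balaban1983to89.B9CoReadingCoordsL2
import Literature.MathematicalPhysics.QuantumFieldTheory.Balaban1983to89.B9CoReadingCoordsGlob
import Literature.MathematicalPhysics.QuantumFieldTheory.Balaban1983to89.B9IndexBondFaithful
import HarnessLib

/-!
# Route `UnitScaleTilt` (α), node N06(d = 3), layer 0 — **THE TEN K-FREE EVALUATION ROWS (+ the two R2-localisation rows) OF THE N06(d = 3) KNITS AT THE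
# CONCRETE T³ LETTER RECORD `opsT3`** (the evaluation `ev = evY := evBK i`, the blocks `blk = blkY := blkBK i (bI i)`, the input block norm `bHXA i := (ε ↦ bHK i (bI i) ε)`
# — pub-ymgap's κ-fold coordinate model at `κ := TrIdx 2`), **and the EX-junction index dictionary `nOf (memberIdx …) = n`**

Cell `ym-inputs` (D-0154 (2); desk `ym-inputs-plan-1` INPUT-LIST v11 §4 row p05 + HOME/HANDOFF.md § «ym-inputs-p05 g2» «WHAT REMAINS (1), (3a)»), seat ym-inputs-p05 g3.
Count-neutral helper (`--kind proof --supports stmt-QuantumFields-20520 --as helper`); registry untouched; THEOREMS ONLY (0 `def`, 0 `sorry`); NOTHING of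
[Balaban1985BackgroundPropagators] is asserted; YM₃ on T³ is rung R3 (RECORD), NOT the Clay problem.

THE POINT.  The three N06(d = 3) knits of this cell — ✓ `Prop7SectET3N06LeavesRecordStepLayerEvalRowsS.normG_row_of_letterLayers_evaluationRowsS` (p03 g2), its H-side
twin ✓ `…HStepLayerEvalRowsS.normH₁_row_of_letterLayers_evaluationRowsS` and the re-cut ✓ `…StepLayerEvalRowsSCut` (p04 g2) — replaced the kernel family `GG` and its six
co-reading rows `hcoR hco1R hcoG hl2N hH1N hIF` by TEN K-FREE EVALUATION ROWS `hoff hoffY hbd hbdY hwb hwbY hl2b hl2bY hloc hlocle` about the instance's evaluation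
maps `ev`∕`evY`, block maps `(𝔬12 i).blk`∕`.blkY` and input block norm `bHXA` (✓ `Prop7SectET3KernelFamilyCanonical.exists_kernelFamily_structural`), plus the two
R2-localisation rows `hvanishX hleX`.  Layer 0's letter record is now in the tree (✓ `Prop7SectET3OpsT3.opsT3`, p05 g2 ✓ p630871; `blk = blkY := blkBK i bI`), so at
`𝔬12 := opsT3 c₀ cB a Δ0 Δπ Δ1 bI bZ bW`, `X = Y := XBK (TrIdx 2)`, `ev = evY := evBK`, `bHXA i := (ε ↦ bHK i (bI i) ε)` (pub-ymgap's input block norm of the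
coordinate carrier, `B9CoReadingCoordsInput` §1) and `Cev := √24` ALL TWELVE ROWS ARE THEOREMS — instances of pub-ymgap's d-generic lemmas (cited by name, nothing re-proved):
`B9CoReadingCoords.off_bound_evBK` (`hoff hoffY hbd hbdY`, also `hloc`), `B9CoReadingCoordsGlob.evBK_wbound` (`hwb hwbY`), `B9CoReadingCoordsL2.l2bound_evBK` (`hl2b hl2bY`,
`√((2+1)·|TrIdx 2|) = √24`), `B9CoReadingCoordsInput.supK_evDiagK_le`∕`holK_evDiagK_le` (`hlocle`; `(geo9K i).suppInT = suppIn` by `rfl`), `B9CoReadingCoordsInputLoc.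
vanishX_bHK_pins`∕`leX_bHK_pins` (`hvanishX hleX`).  The ONLY hypotheses are the two geometric binders of the block map `bI i` — `hlev` (LEVEL-FAITHFUL) and `hβI`
(CARRIER-FAITHFUL) — which ✓ `B9IndexBondFaithful.exists_faithful_kIdx` (dag-n06-k) inhabits jointly (with 1-faithfulness) at every index; §4 packages that as ONE family
`bI` (`exists_faithful_family`), so a knitter sets `bI := (exists_faithful_family).choose` and every row below is an `exact`.

WHAT IS PROVED (ns `…Theorems.Prop7SectET3OpsT3EvalRows`; `i : KIdx 2 ℓ hd3 hL b₀ b₁`, any band `b₀ b₁`, any `R`, `H`):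
* §1 `blk_opsT3`, `blkY_opsT3`, `blkZ_opsT3`, `blkW_opsT3` — the block maps of `opsT3` on BOTH `dite` branches (`blkBK i (bI i)`, `bZ i ∘ fst`, `bW i ∘ fst`).
* §2 ★★ the rows, each in the knit's binder shape VERBATIM with `𝔬12 := opsT3 …`: `hoff_opsT3`, `hoffY_opsT3`, `hbd_opsT3`, `hbdY_opsT3` (from `hβI`); `hwb_opsT3`, `hwbY_opsT3`
  (from `hlev`); `hl2b_opsT3`, `hl2bY_opsT3` (`Cev := √24`, `cev_nonneg`, `card_trIdx_two`); `hloc_opsT3`, `hlocle_opsT3` (from `hβI`); §3 `hvanishX_opsT3`, `hleX_opsT3` and their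
  regularity-prefixed shapes `hvanishX_row_opsT3`, `hleX_row_opsT3` (the prefix `M12 ≤ M → … → Reg335 → Reg336 →` of the knit is idle for these two rows).
* §4 `exists_faithful_family` — one block-map family `bI` that is level-, carrier- and 1-faithful at every index (`choose` over `exists_faithful_kIdx`).
* §5 the EX-junction dictionary: `nOf_memberIdx : nOf (memberIdx ℓ hL hℓ m hm n K a' R hk1 hsize hM8 hR2) = n` (`omega` from `hk1 : 1 ≤ K − n`), `memberIdx_m_pos`,
  `FT3_memberIdx : FT3 (memberIdx …) hm' = ⟨ℓ + 1, hL, m, hm⟩` (`rfl`), `opsT3_memberIdx` (the record at a member index IS the pinned record, `dif_pos`).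
NOT HERE (HOME/HANDOFF.md § p05 g2, unchanged): the readout row `hread` + the κ-assembly over the (115)-normed family, the record re-cut over `{i // 1 ≤ i.m}` (record
lineage ∕ ★★OWNER), `PosOnto`∕`PosPrime`, every schema ∕ letter ∕ analytic row of the knits.
HONEST SCOPE: bookkeeping of landed pub-ymgap lemmas at the letters of layer 0; no estimate of [B9]; N06(d = 3) NOT discharged; nothing here claims EX, the crux, V3∕R3, d = 4
or the mass gap; YM₃ on T³ is ladder rung R3 (RECORD), not the Clay problem.

References: T. Bałaban, CMP **99** (1985) 389–434 [Balaban1985BackgroundPropagators] ((3.39)–(3.41) p.397, (3.44)–(3.46) p.398); CMP **96** (1984) 223–250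
[Balaban1984PropagatorsII] ((2.1)–(2.4) p.224, (2.45)–(2.46) p.231, (2.51)–(2.52) p.232).
-/

set_option autoImplicit false

noncomputable section

open scoped Matrix Matrix.Norms.L2Operator

namespace Summit.QuantumFields.YangMills.Theorems.Prop7SectET3OpsT3EvalRows

open Literature.MathematicalPhysics.QuantumFieldTheory.Balaban1983to89
open Literature.MathematicalPhysics.QuantumFieldTheory.Balaban1983to89.T3ContinuumYM3Torus
open B6KLevelCensusIndexV1 (KIdx)
open B6GlobalChartV1 (PV blkV1 domT)
open B6Ineq2142KLevelV1 (β lvl)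
open B6Geom246MultiLevelTorus (geomT)
open B9GeoNormsKLevelV1 (geo9K geo9K_supNorm_nonneg geo9K_holder_nonneg)
open B9Thm34Ext (toB6)
open B11SectG (BlockNorm)
open B9SectDL2Decay (bl2)
open B11Eq103H1Complex (BondL2K)
open B9CoRealizesRelAtLetters (RelB)
open B9CoReadingCoords (XBK evBK blkBK off_bound_evBK)
open B9CoReadingCoordsGlob (evBK_wbound)
open B9CoReadingCoordsL2 (l2bound_evBK)
open B9CoReadingCoordsInput (bHK supK holK supK_evDiagK_le holK_evDiagK_le)
open B9CoReadingCoordsInputLoc (vanishX_bHK_pins leX_bHK_pins)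
open B9CoReadingCoordsTranspose (TrIdx)
open B9IndexBondFaithful (exists_faithful_kIdx)
open Node00 (FBondY IBondY)
open Summit.QuantumFields.YangMills.Theorems.Prop7SectET3Members (hd3 memberIdx)
open Summit.QuantumFields.YangMills.Theorems.Prop7SectET3BgClass (bgT3)
open Summit.QuantumFields.YangMills.Theorems.Prop7SectET3Transport (periodsT3)
open Summit.QuantumFields.YangMills.Theorems.Prop7SectET3HilbertLetters (W₂)
open Summit.QuantumFields.YangMills.Theorems.Prop7SectET3OpsT3 (nOf FT3 opsT3 opsT3Pins opsT3_of_pos opsT3_of_not)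

variable {ℓ : ℕ} {hL : Odd (ℓ + 1) ∧ 1 < ℓ + 1} {b₀ b₁ : ℝ}

section Record

variable (c₀ cB a : ℝ) [Fact (0 < c₀)] [Fact (0 < cB)]
  (Δ0 Δπ Δ1 : ∀ (i : KIdx 2 ℓ hd3 hL b₀ b₁) (hm : 1 ≤ i.m), GaugeField ((FT3 i hm).P i.K) 0 (Matrix.specialUnitaryGroup (Fin 2) ℂ) →
    (BondL2K ℂ 3 (periodsT3 (FT3 i hm) i.K) c₀ W₂ →ₗ[ℂ] BondL2K ℂ 3 (periodsT3 (FT3 i hm) i.K) c₀ W₂))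
  (bI : ∀ i : KIdx 2 ℓ hd3 hL b₀ b₁, FBondY i → IBondY i) (bZ : ∀ i : KIdx 2 ℓ hd3 hL b₀ b₁, PBond (PV 2 ℓ i.m (nOf i) hd3 hL) 0 → IBondY i)
  (bW : ∀ i : KIdx 2 ℓ hd3 hL b₀ b₁, Site (PV 2 ℓ i.m i.K hd3 hL) 0 → IBondY i)

/-! ## §1 The block maps of the record (both `dite` branches) -/

/-- the X-block map of the record is `blkBK i (bI i)` at EVERY index (pinned and junk branch alike). [cite: Balaban1985BackgroundPropagators, (3.39) p.397, bookkeeping] -/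
theorem blk_opsT3 (i : KIdx 2 ℓ hd3 hL b₀ b₁) : (opsT3 c₀ cB a Δ0 Δπ Δ1 bI bZ bW i).blk = blkBK i (bI i) := by
  by_cases hm : 1 ≤ i.m
  · rw [opsT3_of_pos hm]; rfl
  · rw [opsT3_of_not hm]; rfl

/-- the Y-block map of the record is `blkBK i (bI i)` at every index. [cite: Balaban1985BackgroundPropagators, (3.39) p.397, bookkeeping] -/
theorem blkY_opsT3 (i : KIdx 2 ℓ hd3 hL b₀ b₁) : (opsT3 c₀ cB a Δ0 Δπ Δ1 bI bZ bW i).blkY = blkBK i (bI i) := by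
  by_cases hm : 1 ≤ i.m
  · rw [opsT3_of_pos hm]; rfl
  · rw [opsT3_of_not hm]; rfl

/-- the Z-block map of the record is `bZ i ∘ fst` at every index. [cite: Balaban1985BackgroundPropagators, (3.110) p.417, bookkeeping] -/
theorem blkZ_opsT3 (i : KIdx 2 ℓ hd3 hL b₀ b₁) : (opsT3 c₀ cB a Δ0 Δπ Δ1 bI bZ bW i).blkZ = fun p => bZ i p.1 := by
  by_cases hm : 1 ≤ i.m
  · rw [opsT3_of_pos hm]; rfl
  · rw [opsT3_of_not hm]; rfl

/-- the W-block map of the record is `bW i ∘ fst` at every index. [cite: Balaban1985BackgroundPropagators, (3.21) p.394, bookkeeping] -/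
theorem blkW_opsT3 (i : KIdx 2 ℓ hd3 hL b₀ b₁) : (opsT3 c₀ cB a Δ0 Δπ Δ1 bI bZ bW i).blkW = fun p => bW i p.1 := by
  by_cases hm : 1 ≤ i.m
  · rw [opsT3_of_pos hm]; rfl
  · rw [opsT3_of_not hm]; rfl

/-! ## §2 ★★ The ten K-free evaluation rows at `ev = evY := evBK i`, `𝔬12 := opsT3 …` -/

/-- `Fintype.card (TrIdx 2) = 8` (`TrIdx 2 = Fin 2 × Fin 2 × Fin 2`). [folklore] -/
theorem card_trIdx_two : Fintype.card (TrIdx 2) = 8 := by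
  simp [TrIdx, Fintype.card_prod, Fintype.card_fin]

/-- `√((2+1)·|TrIdx 2|) = √24` — the L²-constant of `l2bound_evBK` at d = 2, κ = TrIdx 2. [folklore] -/
theorem sqrt_card_eq : Real.sqrt ((((2 : ℕ) : ℝ) + 1) * (Fintype.card (TrIdx 2) : ℝ)) = Real.sqrt 24 := by
  rw [card_trIdx_two]; norm_num

/-- `0 ≤ Cev` for `Cev := √24` (the knits' `hCev`). [folklore] -/
theorem cev_nonneg : (0 : ℝ) ≤ Real.sqrt 24 := Real.sqrt_nonneg _

variable {c₀ cB a Δ0 Δπ Δ1 bI bZ bW}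

/-- ★ row `hoff` at the record: the evaluation of a `λ` supported in the block of `y′` vanishes at coordinates whose block is not related to `y′` (CARRIER-FAITHFUL `bI i`).
[cite: Balaban1985BackgroundPropagators, (3.39) + (3.42) p.397, bookkeeping] -/
theorem hoff_opsT3 (i : KIdx 2 ℓ hd3 hL b₀ b₁)
    (hβI : ∀ (x : FBondY i) (c : IBondY i), blkV1 i.hN i.D x = β i.hN i.D i.hk c → β i.hN i.D i.hk (bI i x) = blkV1 i.hN i.D x) :
    ∀ (lam : (geo9K i).Loc) (y' : (geo9K i).Site), (geo9K i).suppIn lam y' →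
      ∀ x : XBK (TrIdx 2) i, ¬ RelB i ((opsT3 c₀ cB a Δ0 Δπ Δ1 bI bZ bW i).blk x) y' → evBK i lam x = 0 := by
  rw [blk_opsT3]
  exact (off_bound_evBK i hβI).1

/-- ★ row `hoffY` at the record (the Y-carrier IS the X-carrier, `blkY = blk`). [cite: Balaban1985BackgroundPropagators, (3.39) + (3.42) p.397, bookkeeping] -/
theorem hoffY_opsT3 (i : KIdx 2 ℓ hd3 hL b₀ b₁)
    (hβI : ∀ (x : FBondY i) (c : IBondY i), blkV1 i.hN i.D x = β i.hN i.D i.hk c → β i.hN i.D i.hk (bI i x) = blkV1 i.hN i.D x) :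
    ∀ (lam : (geo9K i).Loc) (y' : (geo9K i).Site), (geo9K i).suppIn lam y' →
      ∀ w : XBK (TrIdx 2) i, ¬ RelB i ((opsT3 c₀ cB a Δ0 Δπ Δ1 bI bZ bW i).blkY w) y' → evBK i lam w = 0 := by
  rw [blkY_opsT3]
  exact (off_bound_evBK i hβI).1

/-- ★ row `hbd` at the record: `|evBK lam x| ≤ |λ|`. [cite: Balaban1985BackgroundPropagators, (3.39) p.397, bookkeeping] -/
theorem hbd_opsT3 (i : KIdx 2 ℓ hd3 hL b₀ b₁)
    (hβI : ∀ (x : FBondY i) (c : IBondY i), blkV1 i.hN i.D x = β i.hN i.D i.hk c → β i.hN i.D i.hk (bI i x) = blkV1 i.hN i.D x) :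
    ∀ (lam : (geo9K i).Loc) (x : XBK (TrIdx 2) i), |evBK i lam x| ≤ (geo9K i).supNorm lam :=
  (off_bound_evBK i hβI).2

/-- ★ row `hbdY` at the record (= `hbd`, one carrier). [cite: Balaban1985BackgroundPropagators, (3.39) p.397, bookkeeping] -/
theorem hbdY_opsT3 (i : KIdx 2 ℓ hd3 hL b₀ b₁)
    (hβI : ∀ (x : FBondY i) (c : IBondY i), blkV1 i.hN i.D x = β i.hN i.D i.hk c → β i.hN i.D i.hk (bI i x) = blkV1 i.hN i.D x) :
    ∀ (lam : (geo9K i).Loc) (w : XBK (TrIdx 2) i), |evBK i lam w| ≤ (geo9K i).supNorm lam :=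
  (off_bound_evBK i hβI).2

/-- ★ row `hwb` at the record: the (3.41) domination `|evBK lam x| ≤ (Lʲη)(blk x)^γ · |λ|_{(γ)}` (LEVEL-FAITHFUL `bI i`). [cite: Balaban1985BackgroundPropagators, (3.41) p.397] -/
theorem hwb_opsT3 (i : KIdx 2 ℓ hd3 hL b₀ b₁) (hlev : ∀ x : FBondY i, lvl i.hN i.D i.hk (bI i x) = (blkV1 i.hN i.D x).1.1) :
    ∀ (lam : (geo9K i).Loc) (γ : ℝ) (x : XBK (TrIdx 2) i),
      |evBK i lam x| ≤ (geo9K i).len ((opsT3 c₀ cB a Δ0 Δπ Δ1 bI bZ bW i).blk x) ^ γ * (geo9K i).wNorm γ lam := by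
  rw [blk_opsT3]
  exact fun lam γ x => evBK_wbound i hlev lam γ x

/-- ★ row `hwbY` at the record (= `hwb`, one carrier). [cite: Balaban1985BackgroundPropagators, (3.41) p.397] -/
theorem hwbY_opsT3 (i : KIdx 2 ℓ hd3 hL b₀ b₁) (hlev : ∀ x : FBondY i, lvl i.hN i.D i.hk (bI i x) = (blkV1 i.hN i.D x).1.1) :
    ∀ (lam : (geo9K i).Loc) (γ : ℝ) (w : XBK (TrIdx 2) i),
      |evBK i lam w| ≤ (geo9K i).len ((opsT3 c₀ cB a Δ0 Δπ Δ1 bI bZ bW i).blkY w) ^ γ * (geo9K i).wNorm γ lam := by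
  rw [blkY_opsT3]
  exact fun lam γ w => evBK_wbound i hlev lam γ w

/-- ★ row `hl2b` at the record with `Cev := √24`: the fibre L²-size of the evaluation is `≤ √((d+1)|κ|)·‖λ‖` (the support ∕ relation hypotheses of the knit's binder are idle).
[cite: Balaban1985BackgroundPropagators, (3.46) p.398 («‖λ‖», «|h|»), bookkeeping] -/
theorem hl2b_opsT3 {R : ℝ} {H : Prop} (i : KIdx 2 ℓ hd3 hL b₀ b₁) [Fintype (geo9K i).Site] :
    ∀ (lam : (geo9K i).Loc) (y' y'' : (geo9K i).Site), (geo9K i).suppIn lam y' → RelB i y'' y' →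
      bl2 (g := toB6 (geo9K i) R H) (opsT3 c₀ cB a Δ0 Δπ Δ1 bI bZ bW i).blk y'' (evBK i lam) ≤ Real.sqrt 24 * (geo9K i).l2Norm lam := by
  rw [blk_opsT3, ← sqrt_card_eq]
  exact fun lam _ y'' _ _ => l2bound_evBK i (bI i) lam y''

/-- ★ row `hl2bY` at the record (= `hl2b`, one carrier). [cite: Balaban1985BackgroundPropagators, (3.46) p.398, bookkeeping] -/
theorem hl2bY_opsT3 {R : ℝ} {H : Prop} (i : KIdx 2 ℓ hd3 hL b₀ b₁) [Fintype (geo9K i).Site] :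
    ∀ (lam : (geo9K i).Loc) (y' y'' : (geo9K i).Site), (geo9K i).suppIn lam y' → RelB i y'' y' →
      bl2 (g := toB6 (geo9K i) R H) (opsT3 c₀ cB a Δ0 Δπ Δ1 bI bZ bW i).blkY y'' (evBK i lam) ≤ Real.sqrt 24 * (geo9K i).l2Norm lam := by
  rw [blkY_opsT3, ← sqrt_card_eq]
  exact fun lam _ y'' _ _ => l2bound_evBK i (bI i) lam y''

/-- ★ row `hloc` at `bHXA i := (ε ↦ bHK i (bI i) ε)`: the evaluation of a `λ` supported in the block of `y′` is `bHK`-localised at `y′` (vanishes off the carrier class; CARRIER-FAITHFUL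
`bI i`; `(geo9K i).suppInT = suppIn`). [cite: Balaban1985BackgroundPropagators, (3.44) p.398 («supp λ ⊂ Δ(y′)»), bookkeeping] -/
theorem hloc_opsT3 {R : ℝ} {H : Prop} (i : KIdx 2 ℓ hd3 hL b₀ b₁) [Fintype (geo9K i).Site] [DecidableRel (RelB i)]
    (hβI : ∀ (x : FBondY i) (c : IBondY i), blkV1 i.hN i.D x = β i.hN i.D i.hk c → β i.hN i.D i.hk (bI i x) = blkV1 i.hN i.D x) :
    ∀ (ε : ℝ) (lam : (geo9K i).Loc) (y' : (geo9K i).Site), (geo9K i).suppInT lam y' → (bHK (κ := TrIdx 2) i (bI i) ε (R := R) (H := H)).IsLoc y' (evBK i lam) :=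
  fun _ lam y' hs => (off_bound_evBK i hβI).1 lam y' hs

/-- ★ row `hlocle` at `bHXA i := (ε ↦ bHK i (bI i) ε)`: `|λ|_{Δ(y′)} + ‖λ‖_{ε,Δ(y′)} ≤ ‖λ‖_ε + |λ|` for the evaluation of a `λ` supported in the block of `y′` (CARRIER-FAITHFUL `bI i`).
[cite: Balaban1985BackgroundPropagators, (3.39)–(3.41) p.397 + (3.44) p.398; Balaban1984PropagatorsII, (2.137) p.247] -/
theorem hlocle_opsT3 {R : ℝ} {H : Prop} (i : KIdx 2 ℓ hd3 hL b₀ b₁) [Fintype (geo9K i).Site] [DecidableRel (RelB i)]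
    (hβI : ∀ (x : FBondY i) (c : IBondY i), blkV1 i.hN i.D x = β i.hN i.D i.hk c → β i.hN i.D i.hk (bI i x) = blkV1 i.hN i.D x) :
    ∀ (ε : ℝ) (lam : (geo9K i).Loc) (y' : (geo9K i).Site), (geo9K i).suppInT lam y' →
      (bHK (κ := TrIdx 2) i (bI i) ε (R := R) (H := H)).loc y' (evBK i lam) ≤ (geo9K i).holder ε lam + (geo9K i).supNorm lam := by
  intro ε lam y' hs
  show supK i (bI i) y' (evBK i lam) + holK i (bI i) ε y' (evBK i lam) ≤ (geo9K i).holder ε lam + (geo9K i).supNorm lam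
  cases lam with
  | inl f =>
      have h0 : evBK (κ := TrIdx 2) i (Sum.inl f) = 0 := rfl
      have hl : supK i (bI i) y' (evBK (κ := TrIdx 2) i (Sum.inl f)) + holK i (bI i) ε y' (evBK (κ := TrIdx 2) i (Sum.inl f)) = 0 := by
        rw [h0]; exact (bHK (R := R) (H := H) i (bI i) ε).loc_zero y'
      rw [hl]; exact add_nonneg (geo9K_holder_nonneg i ε _) (geo9K_supNorm_nonneg i _)
  | inr J =>
      rw [add_comm]
      exact add_le_add (holK_evDiagK_le i hβI ε y' J hs) (supK_evDiagK_le i y' J)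

/-! ## §3 The two R2-localisation rows `hvanishX`, `hleX` at the record -/

/-- ★ row `hvanishX` at the record (U-free core): the fibre pieces of a `bHK`-localised `μ` vanish outside the class.
[cite: Balaban1985BackgroundPropagators, (3.44) p.398; Balaban1984PropagatorsII, (2.45) p.231, bookkeeping] -/
theorem hvanishX_opsT3 {R : ℝ} {H : Prop} (i : KIdx 2 ℓ hd3 hL b₀ b₁) [Fintype (geo9K i).Site] [DecidableRel (RelB i)] :
    ∀ ε : ℝ, 0 < ε → ∀ (y' : (geo9K i).Site) (μ : XBK (TrIdx 2) i → ℝ), (bHK i (bI i) ε (R := R) (H := H)).IsLoc y' μ →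
      ∀ y'' : (geo9K i).Site, ¬ RelB i y'' y' → (BlockNorm.ofBlocks (toB6 (geo9K i) R H) (opsT3 c₀ cB a Δ0 Δπ Δ1 bI bZ bW i).blk).cut y'' μ = 0 := by
  rw [blk_opsT3]
  exact vanishX_bHK_pins i (bI i)

/-- ★ row `hleX` at the record (U-free core): the fibre sup of a fibre piece is `≤` the class size `bHK.loc`.
[cite: Balaban1985BackgroundPropagators, (3.39)–(3.41) p.397, (3.44) p.398; Balaban1984PropagatorsII, (2.51)–(2.52) p.232, bookkeeping] -/
theorem hleX_opsT3 {R : ℝ} {H : Prop} (i : KIdx 2 ℓ hd3 hL b₀ b₁) [Fintype (geo9K i).Site] [DecidableRel (RelB i)] :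
    ∀ ε : ℝ, 0 < ε → ∀ (y' : (geo9K i).Site) (μ : XBK (TrIdx 2) i → ℝ), (bHK i (bI i) ε (R := R) (H := H)).IsLoc y' μ →
      ∀ y'' : (geo9K i).Site, RelB i y'' y' →
        (BlockNorm.ofBlocks (toB6 (geo9K i) R H) (opsT3 c₀ cB a Δ0 Δπ Δ1 bI bZ bW i).blk).loc y''
            ((BlockNorm.ofBlocks (toB6 (geo9K i) R H) (opsT3 c₀ cB a Δ0 Δπ Δ1 bI bZ bW i).blk).cut y'' μ) ≤
          (bHK i (bI i) ε (R := R) (H := H)).loc y' μ := by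
  rw [blk_opsT3]
  exact leX_bHK_pins i (bI i)

/-- row `hvanishX` in the knits' regularity-prefixed binder shape (the prefix `M12 ≤ M → 0 < α₀ → M·α₀ ≤ a12 → Reg335 → Reg336 →` is idle).
[cite: Balaban1985BackgroundPropagators, (3.44) p.398, bookkeeping] -/
theorem hvanishX_row_opsT3 {R : ℝ} {H : Prop} (c35 M12 a12 : ℝ) (i : KIdx 2 ℓ hd3 hL b₀ b₁) [Fintype (geo9K i).Site] [DecidableRel (RelB i)] :
    M12 ≤ (geo9K i).M → ∀ α₀ : ℝ, 0 < α₀ → (geo9K i).M * α₀ ≤ a12 →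
      ∀ U : (bgT3 i).Cfg, (bgT3 i).Reg335 c35 α₀ U → (bgT3 i).Reg336 c35 α₀ U →
        ∀ ε : ℝ, 0 < ε → ∀ (y' : (geo9K i).Site) (μ : XBK (TrIdx 2) i → ℝ), (bHK i (bI i) ε (R := R) (H := H)).IsLoc y' μ →
          ∀ y'' : (geo9K i).Site, ¬ RelB i y'' y' → (BlockNorm.ofBlocks (toB6 (geo9K i) R H) (opsT3 c₀ cB a Δ0 Δπ Δ1 bI bZ bW i).blk).cut y'' μ = 0 :=
  fun _ _ _ _ _ _ _ => hvanishX_opsT3 i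

/-- row `hleX` in the knits' regularity-prefixed binder shape (prefix idle). [cite: Balaban1985BackgroundPropagators, (3.44) p.398, bookkeeping] -/
theorem hleX_row_opsT3 {R : ℝ} {H : Prop} (c35 M12 a12 : ℝ) (i : KIdx 2 ℓ hd3 hL b₀ b₁) [Fintype (geo9K i).Site] [DecidableRel (RelB i)] :
    M12 ≤ (geo9K i).M → ∀ α₀ : ℝ, 0 < α₀ → (geo9K i).M * α₀ ≤ a12 →
      ∀ U : (bgT3 i).Cfg, (bgT3 i).Reg335 c35 α₀ U → (bgT3 i).Reg336 c35 α₀ U →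
        ∀ ε : ℝ, 0 < ε → ∀ (y' : (geo9K i).Site) (μ : XBK (TrIdx 2) i → ℝ), (bHK i (bI i) ε (R := R) (H := H)).IsLoc y' μ →
          ∀ y'' : (geo9K i).Site, RelB i y'' y' →
            (BlockNorm.ofBlocks (toB6 (geo9K i) R H) (opsT3 c₀ cB a Δ0 Δπ Δ1 bI bZ bW i).blk).loc y''
                ((BlockNorm.ofBlocks (toB6 (geo9K i) R H) (opsT3 c₀ cB a Δ0 Δπ Δ1 bI bZ bW i).blk).cut y'' μ) ≤
              (bHK i (bI i) ε (R := R) (H := H)).loc y' μ :=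
  fun _ _ _ _ _ _ _ => hleX_opsT3 i

end Record

/-! ## §4 One block-map family, level-, carrier- and 1-faithful at every index -/

/-- **THE GEOMETRIC BINDERS ARE JOINTLY INHABITED, FAMILY-WIDE**: one `bI : ∀ i, FBondY i → IBondY i` with `hlev`, `hβI`, `hβ1` at every k-level index (d-generic; `choose` over
✓ `B9IndexBondFaithful.exists_faithful_kIdx`). [cite: Balaban1984PropagatorsII, (2.3)–(2.4) p.224, (2.45)–(2.46) p.231; Balaban1985BackgroundPropagators, (3.41) p.397] -/
theorem exists_faithful_family {d : ℕ} {hd : 1 ≤ d + 1} :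
    ∃ bI : ∀ i : KIdx d ℓ hd hL b₀ b₁, FBondY i → IBondY i,
      (∀ (i : KIdx d ℓ hd hL b₀ b₁) (x : FBondY i), lvl i.hN i.D i.hk (bI i x) = (blkV1 i.hN i.D x).1.1) ∧
      (∀ (i : KIdx d ℓ hd hL b₀ b₁) (x : FBondY i) (c : IBondY i), blkV1 i.hN i.D x = β i.hN i.D i.hk c → β i.hN i.D i.hk (bI i x) = blkV1 i.hN i.D x) ∧
      (∀ (i : KIdx d ℓ hd hL b₀ b₁) (x : FBondY i), (geomT i.D).dist (β i.hN i.D i.hk (bI i x)) (blkV1 i.hN i.D x) ≤ 1) := by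
  choose bI hlev hβI hβ1 using fun i : KIdx d ℓ hd hL b₀ b₁ => exists_faithful_kIdx i
  exact ⟨bI, hlev, hβI, hβ1⟩

/-! ## §5 The EX-junction index dictionary at a member index -/

section Junction

variable (hℓ : 4 ≤ ℓ) (m : ℕ) (hm : 1 ≤ m) (n K a' R : ℕ) (hk1 : 1 ≤ K - n) (hsize : a' + 3 ≤ m + n) (hM8 : 8 ≤ (ℓ + 1) ^ a') (hR2 : 2 * (ℓ + 1) ^ 2 ≤ R)

/-- ★ **THE COARSE HEIGHT OF A MEMBER INDEX IS THE MEMBER'S `n`**: `nOf (memberIdx … n K …) = K + 1 − (K − n + 1) = n` (uses `1 ≤ K − n`).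
[cite: Balaban1984PropagatorsII, (2.1)–(2.4) p.224 (dictionary)] -/
theorem nOf_memberIdx : nOf (memberIdx ℓ hL hℓ m hm n K a' R hk1 hsize hM8 hR2) = n := by
  show (memberIdx ℓ hL hℓ m hm n K a' R hk1 hsize hM8 hR2).K + 1 - (memberIdx ℓ hL hℓ m hm n K a' R hk1 hsize hM8 hR2).k = n
  rw [Prop7SectET3Members.memberIdx_K, Prop7SectET3Members.memberIdx_k]
  omega

/-- the member index has `1 ≤ i.m` (so `opsT3` is the PINNED record there, `opsT3_of_pos`). [folklore] -/
theorem memberIdx_m_pos : 1 ≤ (memberIdx ℓ hL hℓ m hm n K a' R hk1 hsize hM8 hR2).m := hm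

/-- the member family of a member index IS the member `⟨ℓ + 1, hL, m, hm⟩` (`rfl`). [cite: Balaban1985Variational, p.278 (the family of tori), dictionary] -/
theorem FT3_memberIdx (hm' : 1 ≤ (memberIdx ℓ hL hℓ m hm n K a' R hk1 hsize hM8 hR2).m) :
    FT3 (memberIdx ℓ hL hℓ m hm n K a' R hk1 hsize hM8 hR2) hm' = (⟨ℓ + 1, hL, m, hm⟩ : T3Family) := rfl

/-- at a member index the record IS the pinned record (`dif_pos` with `memberIdx_m_pos`). [folklore] -/
theorem opsT3_memberIdx (c₀ cB a : ℝ) [Fact (0 < c₀)] [Fact (0 < cB)]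
    (Δ0 Δπ Δ1 : ∀ (i : KIdx 2 ℓ hd3 hL 1 1) (hm : 1 ≤ i.m), GaugeField ((FT3 i hm).P i.K) 0 (Matrix.specialUnitaryGroup (Fin 2) ℂ) →
      (BondL2K ℂ 3 (periodsT3 (FT3 i hm) i.K) c₀ W₂ →ₗ[ℂ] BondL2K ℂ 3 (periodsT3 (FT3 i hm) i.K) c₀ W₂))
    (bI : ∀ i : KIdx 2 ℓ hd3 hL 1 1, FBondY i → IBondY i) (bZ : ∀ i : KIdx 2 ℓ hd3 hL 1 1, PBond (PV 2 ℓ i.m (nOf i) hd3 hL) 0 → IBondY i)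
    (bW : ∀ i : KIdx 2 ℓ hd3 hL 1 1, Site (PV 2 ℓ i.m i.K hd3 hL) 0 → IBondY i) :
    opsT3 c₀ cB a Δ0 Δπ Δ1 bI bZ bW (memberIdx ℓ hL hℓ m hm n K a' R hk1 hsize hM8 hR2) =
      opsT3Pins (memberIdx ℓ hL hℓ m hm n K a' R hk1 hsize hM8 hR2) hm c₀ cB a (Δ0 _ hm) (Δπ _ hm) (Δ1 _ hm) (bI _) (bZ _) (bW _) :=
  opsT3_of_pos hm

end Junction

end Summit.QuantumFields.YangMills.Theorems.Prop7SectET3OpsT3EvalRows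

end
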